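import Literature.NumberTheory.Sieve.FriableMoebiusRootSumBaseSums
import Literature.NumberTheory.LFunctions.LogRieszAbelIntegral
import Literature.NumberTheory.LFunctions.PolynomialRootMoebiusRieszMeanConstant
import Literature.NumberTheory.Sieve.BuchstabFunction
import HarnessLib

/-!
# The friable Möbius–root sum in the base range `2 ≤ y ≤ x ≤ y²`

Topic `Literature/NumberTheory/Sieve`. Everything here is PROVED; no definitions, no named facts. For a
one-polynomial Bateman–Horn system `g` (`IsBatemanHornSystem ![g]`) write `ρ = ρ_g`
(`polyRootCountMod ![g]`), `w(n) = μ(n)ρ(n)/n`, `M(V) = ∑_{n ≤ V} w(n)`,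
`R(v) = ∑_{n ≤ v} w(n) log(v/n)` (log-Riesz mean; `R(v) → C(![g])`, the Bateman–Horn constant, with
Landau's rate), `ω` = Buchstab's function, and

`G_g(x, y) = ∑_{d ≤ x, P⁺(d) < y} μ(d)ρ(d)/d = ∑_{d ∈ smoothNumbersUpTo ⌊x⌋ ⌈y⌉} w(d)`.

* `exists_abs_friableSum_sub_main_le_base` — **the base range of the friable Möbius–root law**: there is
  `C = C(g)` with, for all `2 ≤ y ≤ x`, `log x ≤ 2 log y` (`u = log x/log y ∈ [1, 2]`, `ω(u) = 1/u`),
  `|G_g(x, y) − C(![g]) ω(u)/log y − (R(x/y) − C(![g]))/log y| ≤ C/log² y`.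

The boundary-layer term `(R(x/y) − C(![g]))/log y` is `O(e^{−c√log(x/y)}/log y)` and is genuinely
present: at `x = y` the sum `G_g(y, y) = M(⌊y⌋)` is `O(1/log² y)` while `C(![g])/log y` is not.

Proof (`y ≥ e³`; small `y` is trivial): Buchstab `G = M(X) + ∑_{N ≤ p ≤ X} (ρ(p)/p) G(X/p, p)`
(`FriableMoebiusRootSumIdentity`), `G(X/p, p) = M(X/p)` up to the diagonal `p² = X`
(`…BaseLemmas`), Abel summation through `ϑ_g`, Dirichlet's swap and `∑ 1/(k log k)`, extension to
`n ≤ x/y` (`…BaseSums`), and the log-Riesz evaluation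
`∑_{n ≤ x/y} w(n) log(log(x/n)/log y) = C/log x + (R(x/y) − C)/log y + O(1/log² y)`
(`LogRieszAbel.abs_sum_mul_log_sub_sub_main_le` with Landau's `R(v) = C + O(e^{−c√log v})`).

## References

* G. Tenenbaum, *Introduction to analytic and probabilistic number theory*, Ch. III.6. [Tenenbaum2015]
* E. Landau, Math. Ann. 56 (1903), 645–670, Part II. [LandauMathAnn1903]
-/

open Finset Real Polynomial

noncomputable section

namespace Literature.NumberTheory.Sieve

namespace FriableMoebiusRoot

open Literature.NumberTheory.LFunctions

/-! ### The log-Riesz evaluation of `∑_{n ≤ x/y} w(n) log(log(x/n)/log y)` -/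

/-- **`∑_{n ≤ x/y} w(n)(log log(x/n) − log log y) = C(![g])/log x + (R(x/y) − C(![g]))/log y + O(1/log² y)`**
(`LogRieszAbel.abs_sum_mul_log_sub_sub_main_le` with Landau's `|R(v) − C| ≤ C_R e^{−c√log v}`, whose
`∫_1^∞ dv/v` is at most `C_R(1 + 24/c⁴)`). The statement keeps `log x − log(x/y)` for `log y`.
[cite: LandauMathAnn1903, Part II] -/
theorem exists_abs_sum_mul_loglog_sub_main_le {g : ℤ[X]} (hg : IsBatemanHornSystem ![g]) :
    ∃ I : ℝ, 0 ≤ I ∧ ∀ x y : ℝ, 1 < y → y ≤ x →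
      |(∑ n ∈ Icc 1 ⌊x / y⌋₊, (ArithmeticFunction.moebius n : ℝ) * (polyRootCountMod ![g] n : ℝ) / n *
          (Real.log (Real.log x - Real.log n) - Real.log (Real.log x - Real.log (x / y)))) -
        batemanHornConst ![g] / Real.log x -
        ((∑ n ∈ Icc 1 ⌊x / y⌋₊, (ArithmeticFunction.moebius n : ℝ) * (polyRootCountMod ![g] n : ℝ) / n *
          Real.log (x / y / n)) - batemanHornConst ![g]) / (Real.log x - Real.log (x / y))| ≤
      I / (Real.log x - Real.log (x / y)) ^ 2 := by
  obtain ⟨c, hc, CR, hR⟩ := abs_logRieszMean_moebius_rootCount_sub_batemanHornConst_le hg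
  have hCR : 0 ≤ CR := by
    have h := (abs_nonneg _).trans (hR 1 le_rfl)
    rwa [Real.log_one, Real.sqrt_zero, mul_zero, Real.exp_zero, mul_one] at h
  refine ⟨CR * (1 + 24 / c ^ 4), by positivity, fun x y hy hyx => ?_⟩
  set w : ℕ → ℝ := fun n => (ArithmeticFunction.moebius n : ℝ) * (polyRootCountMod ![g] n : ℝ) / n with hw
  set E : ℝ → ℝ := fun t => CR * Real.exp (-c * Real.sqrt (Real.log t)) with hE
  have hy0 : 0 < y := by linarith
  have hx0 : 0 < x := by linarith
  have hV : 1 ≤ x / y := by rw [le_div_iff₀ hy0]; linarith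
  have hVx : x / y < x := by rw [div_lt_iff₀ hy0]; nlinarith
  have hw0 : w 0 = 0 := by simp [hw]
  have hEb : ∀ t ∈ Set.Icc 1 (x / y), |(∑ n ∈ Icc 1 ⌊t⌋₊, w n * Real.log (t / n)) - batemanHornConst ![g]| ≤ E t := by
    intro t ht
    have h := hR t ht.1
    simp only [hw, hE]
    exact h
  have hEc : ContinuousOn E (Set.Icc 1 (x / y)) := by
    have hlog : ContinuousOn Real.log (Set.Icc 1 (x / y)) :=
      Real.continuousOn_log.mono fun t ht => ne_of_gt (lt_of_lt_of_le one_pos ht.1)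
    exact continuousOn_const.mul (Real.continuous_exp.comp_continuousOn
      (continuousOn_const.mul (Real.continuous_sqrt.comp_continuousOn hlog)))
  have hEi : IntervalIntegrable E MeasureTheory.volume 1 (x / y) := hEc.intervalIntegrable_of_Icc hV
  have hI : ∫ t in (1:ℝ)..(x / y), E t / t ≤ CR * (1 + 24 / c ^ 4) :=
    integral_exp_neg_sqrt_log_div_le hc hCR hV
  have h := LogRieszAbel.abs_sum_mul_log_sub_sub_main_le w hw0 hV hVx hEb hEi hI
  simp only [hw] at h
  exact h

/-! ### Buchstab's identity and the diagonal correction -/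

/-- **`G_g(X, N) = M(X) + ∑_{N ≤ p ≤ X} (ρ(p)/p) M(⌊X/p⌋) + O((deg g)²/(N − 1))`** for `2 ≤ N ≤ X + 1`
with `X ≤ N²` (Buchstab's identity `FriableMoebiusRoot.friableSum_eq_sum_Icc_add_sum_primes`, the
diagonal lemma `abs_friableSum_div_sub_sum_Icc_le` and `∑_{p ≥ N} ρ(p)²/p² ≤ (deg g)²/(N − 1)`).
[cite: Tenenbaum2015, Ch. III.6] -/
theorem abs_friableSum_sub_partialSum_sub_primeSum_le {g : ℤ[X]} (hirr : Irreducible g)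
    (hdeg : 0 < g.natDegree) {X N : ℕ} (hN : 2 ≤ N) (hNX : N ≤ X + 1) (hXN : X ≤ N * N) :
    |(∑ d ∈ Nat.smoothNumbersUpTo X N,
        (ArithmeticFunction.moebius d : ℝ) * (polyRootCountMod ![g] d : ℝ) / d) -
      (∑ d ∈ Icc 1 X, (ArithmeticFunction.moebius d : ℝ) * (polyRootCountMod ![g] d : ℝ) / d) -
      ∑ p ∈ (Finset.Ico N (X + 1)).filter Nat.Prime, (polyRootCountMod ![g] p : ℝ) / p *
        ∑ n ∈ Icc 1 (X / p), (ArithmeticFunction.moebius n : ℝ) * (polyRootCountMod ![g] n : ℝ) / n| ≤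
      (g.natDegree : ℝ) ^ 2 / (N - 1) := by
  rw [friableSum_eq_sum_Icc_add_sum_primes g hNX, add_sub_cancel_left, ← Finset.sum_sub_distrib]
  refine (Finset.abs_sum_le_sum_abs _ _).trans ((Finset.sum_le_sum fun p hp => ?_).trans
    (sum_Ico_prime_sq_div_sq_le hirr hdeg hN X))
  obtain ⟨hpI, hpp⟩ := Finset.mem_filter.mp hp
  have hNp : N ≤ p := (Finset.mem_Ico.mp hpI).1
  have hXp : X ≤ p * p := hXN.trans (Nat.mul_le_mul hNp hNp)
  rw [← mul_sub, abs_mul, abs_of_nonneg (by positivity : (0:ℝ) ≤ (polyRootCountMod ![g] p : ℝ) / p)]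
  exact mul_le_mul_of_nonneg_left (abs_friableSum_div_sub_sum_Icc_le g hpp hXp) (by positivity)

/-! ### The base range, `y ≥ e³` -/

/-- **The base range, main case `y ≥ e³`** (all constants as hypotheses; see
`exists_abs_friableSum_sub_main_le_base` for the packaged statement). [cite: Tenenbaum2015, Ch. III.6] -/
theorem abs_friableSum_sub_main_le_base_of_le {g : ℤ[X]} (hirr : Irreducible g) (hdeg : 0 < g.natDegree)
    {C₀ B K CM I : ℝ} (hC₀ : 0 ≤ C₀) (hB1 : 1 ≤ B) (hK0 : 0 ≤ K)
    (hθ : ∀ t : ℝ, 2 ≤ t →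
      |∑ p ∈ Nat.primesLE ⌊t⌋₊, (polyRootCountMod ![g] p : ℝ) * Real.log p - t| ≤ C₀ * t / Real.log t ^ 2)
    (hB : ∀ V : ℕ,
      |∑ n ∈ Icc 1 V, (ArithmeticFunction.moebius n : ℝ) * (polyRootCountMod ![g] n : ℝ) / n| ≤ B)
    (hK : ∀ V : ℕ, ∑ m ∈ Icc 1 V, (ArithmeticFunction.moebius m : ℝ) ^ 2 *
      (polyRootCountMod ![g] m : ℝ) / m ≤ K * (1 + Real.log V))
    (hM : ∀ x : ℝ, 2 ≤ x →
      |∑ n ∈ Icc 1 ⌊x⌋₊, (ArithmeticFunction.moebius n : ℝ) * (polyRootCountMod ![g] n : ℝ) / n| ≤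
        CM / Real.log x ^ 2)
    (hmain : ∀ x y : ℝ, 1 < y → y ≤ x →
      |(∑ n ∈ Icc 1 ⌊x / y⌋₊, (ArithmeticFunction.moebius n : ℝ) * (polyRootCountMod ![g] n : ℝ) / n *
          (Real.log (Real.log x - Real.log n) - Real.log (Real.log x - Real.log (x / y)))) -
        batemanHornConst ![g] / Real.log x -
        ((∑ n ∈ Icc 1 ⌊x / y⌋₊, (ArithmeticFunction.moebius n : ℝ) * (polyRootCountMod ![g] n : ℝ) / n *
          Real.log (x / y / n)) - batemanHornConst ![g]) / (Real.log x - Real.log (x / y))| ≤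
      I / (Real.log x - Real.log (x / y)) ^ 2)
    {x y : ℝ} (hy : Real.exp 3 ≤ y) (hyx : y ≤ x) (hxy : Real.log x ≤ 2 * Real.log y) :
    |(∑ d ∈ Nat.smoothNumbersUpTo ⌊x⌋₊ ⌈y⌉₊,
        (ArithmeticFunction.moebius d : ℝ) * (polyRootCountMod ![g] d : ℝ) / d) -
      batemanHornConst ![g] / Real.log x -
      ((∑ n ∈ Icc 1 ⌊x / y⌋₊, (ArithmeticFunction.moebius n : ℝ) * (polyRootCountMod ![g] n : ℝ) / n *
          Real.log (x / y / n)) - batemanHornConst ![g]) / Real.log y| ≤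
      (CM + 4 * (g.natDegree : ℝ) ^ 2 + (C₀ + 4) * (12 * B + 2 * K) + 56 * K + I) / Real.log y ^ 2 := by
  obtain ⟨hy20, hly3, -, -, -, hx2, hy4⟩ := base_numerics hy hyx hxy
  have hy0 : 0 < y := by linarith
  have hx0 : 0 < x := by linarith
  have hly : 0 < Real.log y := by linarith
  have hlxy : Real.log x - Real.log (x / y) = Real.log y := by rw [Real.log_div hx0.ne' hy0.ne']; ring
  have hlx : Real.log y ≤ Real.log x := Real.log_le_log hy0 hyx
  have hNy : y ≤ (⌈y⌉₊ : ℝ) := Nat.le_ceil y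
  have hN21 : 21 ≤ ⌈y⌉₊ := Nat.lt_ceil.mpr (by exact_mod_cast hy20)
  have hNX : ⌈y⌉₊ ≤ ⌊x⌋₊ + 1 := (Nat.ceil_le_ceil hyx).trans (Nat.ceil_le_floor_add_one x)
  have hXN : ⌊x⌋₊ ≤ ⌈y⌉₊ * ⌈y⌉₊ := by
    have h1 : (⌊x⌋₊ : ℝ) ≤ x := Nat.floor_le hx0.le
    have h2 : x ≤ (⌈y⌉₊ : ℝ) * ⌈y⌉₊ := by nlinarith
    exact_mod_cast h1.trans h2
  -- the six estimates
  have e0 := hM x (by linarith)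
  have e5 := abs_friableSum_sub_partialSum_sub_primeSum_le hirr hdeg (by omega) hNX hXN
  have e1 := abs_primeSum_sub_hyperbolaSum_le hC₀ hB1 hK0 hθ hB hK hy hyx hxy
  have e2 := abs_hyperbolaSum_sub_sum_mul_loglog_le (g := g) hK0 hK hy hyx hxy
  have e3 := abs_sum_floor_sub_sum_div_le (g := g) hK0 hK hy hyx hxy
  have e4 := hmain x y (by linarith) hyx
  rw [hlxy] at e2 e3 e4
  -- conversions to `1/log² y`
  have hCM : 0 ≤ CM := by
    have h := (abs_nonneg _).trans (hM 2 le_rfl)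
    rw [le_div_iff₀ (pow_pos (Real.log_pos one_lt_two) 2), zero_mul] at h
    exact h
  have e0' : CM / Real.log x ^ 2 ≤ CM / Real.log y ^ 2 :=
    div_le_div_of_nonneg_left hCM (by positivity) (pow_le_pow_left₀ hly.le hlx 2)
  have e5' : (g.natDegree : ℝ) ^ 2 / ((⌈y⌉₊ : ℝ) - 1) ≤ 4 * (g.natDegree : ℝ) ^ 2 / Real.log y ^ 2 := by
    have h1 : 1 / ((⌈y⌉₊ : ℝ) - 1) ≤ 1 / (y - 1) := one_div_le_one_div_of_le (by linarith) (by linarith)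
    calc (g.natDegree : ℝ) ^ 2 / ((⌈y⌉₊ : ℝ) - 1) = (g.natDegree : ℝ) ^ 2 * (1 / ((⌈y⌉₊ : ℝ) - 1)) := by ring
      _ ≤ (g.natDegree : ℝ) ^ 2 * (4 / Real.log y ^ 2) :=
          mul_le_mul_of_nonneg_left (h1.trans hy4) (by positivity)
      _ = 4 * (g.natDegree : ℝ) ^ 2 / Real.log y ^ 2 := by ring
  -- assemble
  have hsplit : (CM + 4 * (g.natDegree : ℝ) ^ 2 + (C₀ + 4) * (12 * B + 2 * K) + 56 * K + I) / Real.log y ^ 2 =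
      CM / Real.log y ^ 2 + 4 * (g.natDegree : ℝ) ^ 2 / Real.log y ^ 2 +
        (C₀ + 4) * (12 * B + 2 * K) / Real.log y ^ 2 + 48 * K / Real.log y ^ 2 + 8 * K / Real.log y ^ 2 +
        I / Real.log y ^ 2 := by ring
  rw [hsplit]
  rw [abs_le] at e0 e1 e2 e3 e4 e5 ⊢
  constructor <;> linarith [e0.1, e0.2, e1.1, e1.2, e2.1, e2.2, e3.1, e3.2, e4.1, e4.2, e5.1, e5.2]

/-! ### The base range, packaged -/

/-- **The friable Möbius–root law in the base range `2 ≤ y ≤ x ≤ y²`**: for a one-polynomial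
Bateman–Horn system `g` there is `C` such that for all `2 ≤ y ≤ x` with `log x ≤ 2 log y`
(`u = log x/log y ∈ [1, 2]`),
`|G_g(x, y) − C(![g]) ω(u)/log y − (R(x/y) − C(![g]))/log y| ≤ C/log² y`,
where `G_g(x, y) = ∑_{d ≤ x, P⁺(d) < y} μ(d)ρ_g(d)/d`, `ω` is Buchstab's function (`ω(u) = 1/u` here) and
`R(v) = ∑_{n ≤ v} μ(n)ρ_g(n)/n · log(v/n)` is the log-Riesz mean (`→ C(![g])`). [cite: Tenenbaum2015, Ch. III.6] -/
theorem exists_abs_friableSum_sub_main_le_base {g : ℤ[X]} (hg : IsBatemanHornSystem ![g]) :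
    ∃ C : ℝ, 0 ≤ C ∧ ∀ x y : ℝ, 2 ≤ y → y ≤ x → Real.log x ≤ 2 * Real.log y →
      |(∑ d ∈ Nat.smoothNumbersUpTo ⌊x⌋₊ ⌈y⌉₊,
          (ArithmeticFunction.moebius d : ℝ) * (polyRootCountMod ![g] d : ℝ) / d) -
        batemanHornConst ![g] * buchstabOmega (Real.log x / Real.log y) / Real.log y -
        ((∑ n ∈ Icc 1 ⌊x / y⌋₊, (ArithmeticFunction.moebius n : ℝ) * (polyRootCountMod ![g] n : ℝ) / n *
            Real.log (x / y / n)) - batemanHornConst ![g]) / Real.log y| ≤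
        C / Real.log y ^ 2 := by
  have hirr : Irreducible g := bh_single_irreducible hg
  have hdeg : 0 < g.natDegree := by simpa using hg.natDegree_pos 0
  obtain ⟨B, hB1, hB⟩ := exists_abs_partialSum_le hirr hdeg
  obtain ⟨C₀, hC₀, hθ⟩ := DegreeOnePrimes.abs_thetaRoot_sub_self_le hirr hdeg
  obtain ⟨K, hK0, hK⟩ := DegreeOnePrimes.sum_moebius_sq_rootCount_div_le hirr hdeg
  obtain ⟨CM, hM⟩ := abs_sum_moebius_rootCount_div_le hirr hdeg
  obtain ⟨I, hI0, hmain⟩ := exists_abs_sum_mul_loglog_sub_main_le hg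
  obtain ⟨c, hc, CR, hR⟩ := abs_logRieszMean_moebius_rootCount_sub_batemanHornConst_le hg
  have hCR : 0 ≤ CR := by
    have h := (abs_nonneg _).trans (hR 1 le_rfl)
    rwa [Real.log_one, Real.sqrt_zero, mul_zero, Real.exp_zero, mul_one] at h
  have hCM : 0 ≤ CM := by
    have h := (abs_nonneg _).trans (hM 2 le_rfl)
    rwa [le_div_iff₀ (pow_pos (Real.log_pos one_lt_two) 2), zero_mul] at h
  set Cg := batemanHornConst ![g] with hCg
  set CL : ℝ := CM + 4 * (g.natDegree : ℝ) ^ 2 + (C₀ + 4) * (12 * B + 2 * K) + 56 * K + I with hCL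
  set T₀ : ℝ := 7 * K + 2 * |Cg| + 2 * CR with hT₀
  have hCL0 : 0 ≤ CL := by simp only [hCL]; positivity
  have hT00 : 0 ≤ T₀ := by simp only [hT₀]; positivity
  refine ⟨CL + 9 * T₀, by positivity, fun x y hy2 hyx hxy => ?_⟩
  have hy0 : 0 < y := by linarith
  have hx0 : 0 < x := by linarith
  have hl2 : (1:ℝ) / 2 < Real.log 2 := by have := Real.log_two_gt_d9; linarith
  have hly : Real.log 2 ≤ Real.log y := Real.log_le_log two_pos hy2
  have hly0 : 0 < Real.log y := by linarith
  have hlx : Real.log y ≤ Real.log x := Real.log_le_log hy0 hyx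
  -- `C ω(u)/log y = C/log x`
  have hω : Cg * buchstabOmega (Real.log x / Real.log y) / Real.log y = Cg / Real.log x := by
    rw [buchstabOmega_eq_inv ((one_le_div hly0).mpr hlx) ((div_le_iff₀ hly0).mpr hxy)]
    field_simp
  rw [hω]
  have hres : CL / Real.log y ^ 2 ≤ (CL + 9 * T₀) / Real.log y ^ 2 :=
    div_le_div_of_nonneg_right (by linarith) (by positivity)
  rcases le_or_gt (Real.exp 3) y with hy3 | hy3
  · exact (abs_friableSum_sub_main_le_base_of_le hirr hdeg hC₀ hB1 hK0 hθ hB hK hM hmain hy3 hyx hxy).trans hres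
  -- small `y`: everything is trivially bounded
  have hly3 : Real.log y < 3 := by rw [Real.log_lt_iff_lt_exp hy0]; exact hy3
  have hX0 : 0 < ⌊x⌋₊ := Nat.floor_pos.mpr (by linarith)
  have hlogX : Real.log (⌊x⌋₊ : ℝ) ≤ 6 := by
    calc Real.log (⌊x⌋₊ : ℝ) ≤ Real.log x := Real.log_le_log (by exact_mod_cast hX0) (Nat.floor_le hx0.le)
      _ ≤ 6 := by linarith
  -- `|G| ≤ 7K`
  have hG : |∑ d ∈ Nat.smoothNumbersUpTo ⌊x⌋₊ ⌈y⌉₊,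
      (ArithmeticFunction.moebius d : ℝ) * (polyRootCountMod ![g] d : ℝ) / d| ≤ 7 * K := by
    refine (Finset.abs_sum_le_sum_abs _ _).trans ?_
    calc ∑ d ∈ Nat.smoothNumbersUpTo ⌊x⌋₊ ⌈y⌉₊, |(ArithmeticFunction.moebius d : ℝ) * (polyRootCountMod ![g] d : ℝ) / d|
        ≤ ∑ d ∈ Icc 1 ⌊x⌋₊, |(ArithmeticFunction.moebius d : ℝ) * (polyRootCountMod ![g] d : ℝ) / d| :=
          Finset.sum_le_sum_of_subset_of_nonneg (smoothNumbersUpTo_subset_Icc ⌊x⌋₊ ⌈y⌉₊)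
            fun _ _ _ => abs_nonneg _
      _ = ∑ d ∈ Icc 1 ⌊x⌋₊, (ArithmeticFunction.moebius d : ℝ) ^ 2 * (polyRootCountMod ![g] d : ℝ) / d := by
          refine Finset.sum_congr rfl fun d _ => ?_
          rw [abs_div, abs_mul, abs_moebius_eq_sq, Nat.abs_cast, Nat.abs_cast]
      _ ≤ K * (1 + Real.log (⌊x⌋₊ : ℝ)) := hK ⌊x⌋₊
      _ ≤ K * 7 := mul_le_mul_of_nonneg_left (by linarith) hK0
      _ = 7 * K := by ring
  -- `|C/log x| ≤ 2|C|`, `|(R − C)/log y| ≤ 2 C_R`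
  have hlx0 : 0 < Real.log x := by linarith
  have hC : |Cg / Real.log x| ≤ 2 * |Cg| := by
    rw [abs_div, abs_of_pos hlx0, div_le_iff₀ hlx0]
    have := mul_le_mul_of_nonneg_left (show (1:ℝ) ≤ 2 * Real.log x by linarith) (abs_nonneg Cg)
    linarith
  have hBL : |((∑ n ∈ Icc 1 ⌊x / y⌋₊, (ArithmeticFunction.moebius n : ℝ) * (polyRootCountMod ![g] n : ℝ) / n *
      Real.log (x / y / n)) - Cg) / Real.log y| ≤ 2 * CR := by
    have hV : 1 ≤ x / y := by rw [le_div_iff₀ hy0]; linarith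
    have h := hR (x / y) hV
    have he : CR * Real.exp (-c * Real.sqrt (Real.log (x / y))) ≤ CR := by
      calc CR * Real.exp (-c * Real.sqrt (Real.log (x / y))) ≤ CR * 1 := by
            refine mul_le_mul_of_nonneg_left ?_ hCR
            rw [Real.exp_le_one_iff]
            have := Real.sqrt_nonneg (Real.log (x / y))
            nlinarith
        _ = CR := mul_one _
    rw [abs_div, abs_of_pos hly0, div_le_iff₀ hly0]
    nlinarith [h.trans he]
  have htot : |(∑ d ∈ Nat.smoothNumbersUpTo ⌊x⌋₊ ⌈y⌉₊,
        (ArithmeticFunction.moebius d : ℝ) * (polyRootCountMod ![g] d : ℝ) / d) - Cg / Real.log x -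
      ((∑ n ∈ Icc 1 ⌊x / y⌋₊, (ArithmeticFunction.moebius n : ℝ) * (polyRootCountMod ![g] n : ℝ) / n *
        Real.log (x / y / n)) - Cg) / Real.log y| ≤ T₀ := by
    refine (abs_sub _ _).trans ((add_le_add ((abs_sub _ _).trans (add_le_add hG hC)) hBL).trans ?_)
    simp only [hT₀]; linarith
  refine htot.trans ?_
  rw [le_div_iff₀ (by positivity)]
  have h9 : Real.log y ^ 2 ≤ 9 := by nlinarith
  nlinarith [mul_le_mul_of_nonneg_left h9 hT00, mul_nonneg hCL0 (sq_nonneg (Real.log y))]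

end FriableMoebiusRoot

end Literature.NumberTheory.Sieve
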